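import Summits.SmoothPoincare4.SmoothPoincare4.Theorems.EntropyRungBakryEmeryLogSobolevGradientDissipation
import Summits.SmoothPoincare4.SmoothPoincare4.Theorems.EntropyRungBakryEmeryLogSobolevKinematic
import Summits.SmoothPoincare4.SmoothPoincare4.Theorems.EntropyRungNoncompactShrinkerGapHeatFisherCutoff
import HarnessLib

/-!
# The cut-off dissipation inequality of the Fisher information with a first-order (Gaffney)
# cut-off (support item `EntropyRung.BakryEmeryLogSobolev`, stmt-SmoothPoincare4-16587)

Setting: `M` modelled on `ℝⁿ` (Hausdorff, second countable, `T₃`, Borel — NOT compact), `g`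
Riemannian with its Levi-Civita connection, `V` smooth with `Ric + Hess V ≥ K g` (NO other
assumption on `V`), `L = Δ_g − g⁻¹(dV, d·)`, weight `e^{-V} dV_g`.

* `fisher_cutoffSq_le` — **the dissipation inequality of the cut-off Fisher information in
  `φ`-form, first-order version.** For `φ` smooth on `M × S` solving `∂ₜφ = Lφ − |∇φ|²` (the
  equation of `φ = −log u` along the weighted heat flow `∂ₜu = Lu`), a smooth compactly supported
  cut-off `η` with `|η| ≤ 1`, `|∇η|² ≤ δ²`, and a slice with `|∇φ(t)|² ≤ L₀²` and
  `|∇φ|² e^{-φ} e^{-V} ∈ L¹` at time `t`: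
  `∫ η² ∂ₜ(|∇φ|² e^{-φ} e^{-V}) ≤ −2K ∫ η² |∇φ|² e^{-φ} e^{-V} + (2δ² + 2δL₀) ∫ |∇φ|² e^{-φ} e^{-V}`.

Proof: with `Q = |∇φ|²`, `∂ₜ(Q e^{-φ}) = e^{-φ}(2g⁻¹(dφ, d(Lφ)) − 2g⁻¹(dφ, dQ) − Q Lφ + Q²)`;
`2 g⁻¹(dφ, d(Lφ)) = LQ − 2KQ − 2S` with the slack `S ≥ 0` of the pointwise `Γ₂ ≥ KΓ` inequality
(`weightedBochner_pointwise_ge`); the two weighted Green identities against the compactly supported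
factors `e^{-φ}η²` and `e^{-φ}Qη²` (`integral_mul_cutoffSq_mul_weightedLaplacian`) leave
`−2K I_η − 2∫η²Se^{-φ}e^{-V} − 2∫e^{-φ}η g⁻¹(dη,dQ)e^{-V} + 2∫e^{-φ}Qη g⁻¹(dη,dφ)e^{-V}`; the Hessian error
`g⁻¹(dη, dQ)` is absorbed into `S` (`innerDual_gradSq_sq_le_slack`, `slack_absorb`), and the cubic
term is `≤ 2δL₀ Q e^{-φ}`. This replaces the `|Lη| ≤ C` error term of the shrinker toolkit's
`fisherCutoff_le`. Everything is proved; no definitions, no named facts.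

## References

* [BakryGentilLedoux2014] D. Bakry, I. Gentil, M. Ledoux (2014), Prop. 5.7.1 (p. 268) with §3.2
  (pp. 141–147: cut-offs `ζ_k`, `Γ(ζ_k) ≤ 1/k`) and §C.6.
* [CarrilloNi2009] J. A. Carrillo, L. Ni, Comm. Anal. Geom. 17 (2009), §3 (p. 8) and §4.
* [BakryEmery1985] D. Bakry, M. Émery, LNM 1123 (1985) 177–206.
-/

noncomputable section

set_option linter.dupNamespace false

open scoped Manifold ContDiff ENNReal NNReal Topology
open MeasureTheory Set Filter
open Literature.Geometry.Lorentzian Literature.Geometry.Riemannian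

namespace Summit.SmoothPoincare4.SmoothPoincare4.Theorems.BakryEmeryComplete

open NoncompactShrinkerGapHeat NoncompactShrinkerGapHeat.CutoffToolkit

section Fisher

variable {n : ℕ} {M : Type*} [TopologicalSpace M] [T2Space M] [SecondCountableTopology M]
  [ChartedSpace (EuclideanSpace ℝ (Fin n)) M] [IsManifold (𝓡 n) ∞ M] [T3Space M]
  [MeasurableSpace M] [BorelSpace M]
  {g : PseudoRiemannianMetric (𝓡 n) ∞ (EuclideanSpace ℝ (Fin n)) (TangentSpace (𝓡 n) : M → Type _)}
  [g.HasLeviCivita]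

/-- **The dissipation inequality of the cut-off Fisher information, first-order version** (see the
module docstring): at `t ∈ S`,
`∫ η² ∂ₜ(|∇φ|²e^{-φ}e^{-V}) ≤ −2K ∫ η²|∇φ|²e^{-φ}e^{-V} + (2δ² + 2δL₀) ∫ |∇φ|²e^{-φ}e^{-V}` for
`φ` solving `∂ₜφ = Lφ − |∇φ|²` within `S`, `|η| ≤ 1`, `|∇η|² ≤ δ²`, `|∇φ(t)|² ≤ L₀²`,
`|∇φ(t)|²e^{-φ(t)}e^{-V} ∈ L¹`. [cite: BakryGentilLedoux2014, Prop. 5.7.1 (p. 268) with §3.2 (pp. 141–147)]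
[cite: CarrilloNi2009, §3 (p. 8)] -/
theorem fisher_cutoffSq_le (hg : g.IsRiemannian) {V : M → ℝ} {K : ℝ}
    (hV : ContMDiff (𝓡 n) 𝓘(ℝ, ℝ) ∞ V)
    (hRic : ∀ (y : M) (X : TangentSpace (𝓡 n) y), K * g.val y X X ≤ g.ricci y X X + g.hessian V y X X)
    {φ : ℝ → M → ℝ} {S : Set ℝ} (hS : UniqueDiffOn ℝ S) (hS' : S ⊆ closure (interior S))
    (hφ : ContMDiffOn ((𝓡 n).prod 𝓘(ℝ, ℝ)) 𝓘(ℝ, ℝ) ∞ (fun p : M × ℝ ↦ φ p.2 p.1) (univ ×ˢ S))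
    (heq : ∀ t ∈ S, ∀ y : M, derivWithin (fun s ↦ φ s y) S t =
      g.dalembertian (φ t) y
        - g.innerDual y (mvfderiv (𝓡 n) V y).toLinearMap (mvfderiv (𝓡 n) (φ t) y).toLinearMap
        - g.gradSq (φ t) y)
    {η : M → ℝ} (hη : ContMDiff (𝓡 n) 𝓘(ℝ, ℝ) ∞ η) (hηc : HasCompactSupport η) (hη1 : ∀ y, |η y| ≤ 1)
    {δ : ℝ} (hδ : 0 ≤ δ) (hηgrad : ∀ y, g.gradSq η y ≤ δ ^ 2)
    {t : ℝ} (ht : t ∈ S) {L₀ : ℝ} (hL₀ : 0 ≤ L₀) (hφgrad : ∀ y, g.gradSq (φ t) y ≤ L₀ ^ 2)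
    (hint : Integrable (fun y ↦ g.gradSq (φ t) y * Real.exp (-φ t y) * Real.exp (-V y)) g.riemVolume) :
    ∫ y, η y ^ 2 * derivWithin (fun s ↦ g.gradSq (φ s) y * Real.exp (-φ s y) * Real.exp (-V y)) S t
        ∂g.riemVolume ≤
      -2 * K * ∫ y, η y ^ 2 * (g.gradSq (φ t) y * Real.exp (-φ t y) * Real.exp (-V y)) ∂g.riemVolume
      + (2 * δ ^ 2 + 2 * δ * L₀) *
          ∫ y, g.gradSq (φ t) y * Real.exp (-φ t y) * Real.exp (-V y) ∂g.riemVolume := by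
  haveI := CarrilloNi2009_shrinkerLSI.isFiniteMeasureOnCompacts_riemVolume hg
  have h1le : (1 : ℕ∞ω) ≤ (∞ : ℕ∞ω) := WithTop.coe_le_coe.mpr le_top
  have h2le : (2 : ℕ∞ω) ≤ (∞ : ℕ∞ω) := WithTop.coe_le_coe.mpr le_top
  set μ : Measure M := g.riemVolume with hμ
  /- the static functions at time `t` -/
  set F : M → ℝ := φ t with hFdef
  have hF : ContMDiff (𝓡 n) 𝓘(ℝ, ℝ) ∞ F :=
    hφ.comp_contMDiff (contMDiff_id.prodMk contMDiff_const) fun y ↦ ⟨mem_univ _, ht⟩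
  set Q : M → ℝ := g.gradSq F with hQdef
  have hQ : ContMDiff (𝓡 n) 𝓘(ℝ, ℝ) ∞ Q := contMDiff_gradSq g hF
  set LF : M → ℝ := fun y ↦ g.dalembertian F y
    - g.innerDual y (mvfderiv (𝓡 n) V y).toLinearMap (mvfderiv (𝓡 n) F y).toLinearMap with hLFdef
  have hLF : ContMDiff (𝓡 n) 𝓘(ℝ, ℝ) ∞ LF := (contMDiff_dalembertian g hF).sub (contMDiff_innerDual g hV hF)
  set LQ : M → ℝ := fun y ↦ g.dalembertian Q y
    - g.innerDual y (mvfderiv (𝓡 n) V y).toLinearMap (mvfderiv (𝓡 n) Q y).toLinearMap with hLQdef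
  set Sl : M → ℝ := fun y ↦ (1 / 2) * LQ y
    - g.innerDual y (mvfderiv (𝓡 n) F y).toLinearMap (mvfderiv (𝓡 n) LF y).toLinearMap - K * Q y
    with hSldef
  set E : M → ℝ := fun y ↦ Real.exp (-F y) with hEdef
  have hE : ContMDiff (𝓡 n) 𝓘(ℝ, ℝ) ∞ E := (Real.contDiff_exp.comp contDiff_neg).comp_contMDiff hF
  have hE0 : ∀ y, 0 ≤ E y := fun y ↦ (Real.exp_pos _).le
  have hW : Continuous fun y ↦ Real.exp (-V y) := Real.continuous_exp.comp hV.continuous.neg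
  have hSl0 : ∀ y, 0 ≤ Sl y := fun y ↦ by
    have h := weightedBochner_pointwise_ge g hg hV hRic hF y
    simp only [hSldef, hLQdef, hQdef, hLFdef]
    linarith [h]
  have hslack : ∀ y, (g.innerDual y (mvfderiv (𝓡 n) η y).toLinearMap
      (mvfderiv (𝓡 n) Q y).toLinearMap) ^ 2 ≤ 4 * g.gradSq η y * Q y * Sl y := fun y ↦
    innerDual_gradSq_sq_le_slack g hg hV hRic hF hη y
  -- differentiability
  have hFd : ∀ y, MDifferentiableAt (𝓡 n) 𝓘(ℝ, ℝ) F y := fun y ↦ hF.mdifferentiableAt (by simp)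
  have hQd : ∀ y, MDifferentiableAt (𝓡 n) 𝓘(ℝ, ℝ) Q y := fun y ↦ hQ.mdifferentiableAt (by simp)
  have hLFd : ∀ y, MDifferentiableAt (𝓡 n) 𝓘(ℝ, ℝ) LF y := fun y ↦ hLF.mdifferentiableAt (by simp)
  have hEd : ∀ y, MDifferentiableAt (𝓡 n) 𝓘(ℝ, ℝ) E y := fun y ↦ hE.mdifferentiableAt (by simp)
  /- Step 1: the time derivative, pointwise -/
  have hdot_eq : (fun y ↦ derivWithin (fun s ↦ φ s y) S t) = fun y ↦ LF y - Q y := funext fun y ↦ heq t ht y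
  have hqd : ∀ y, derivWithin (fun s ↦ g.gradSq (φ s) y) S t =
      2 * (g.innerDual y (mvfderiv (𝓡 n) F y).toLinearMap (mvfderiv (𝓡 n) LF y).toLinearMap
        - g.innerDual y (mvfderiv (𝓡 n) F y).toLinearMap (mvfderiv (𝓡 n) Q y).toLinearMap) := by
    intro y
    rw [derivWithin_gradSq_eq_two_innerDual (g := g) hS hS' hφ ht y, hdot_eq,
      mvfderiv_fun_sub (hLFd y) (hQd y), ContinuousLinearMap.toLinearMap_sub,
      g.innerDual_comm y (mvfderiv (𝓡 n) F y).toLinearMap, g.innerDual_sub_left,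
      g.innerDual_comm y (mvfderiv (𝓡 n) LF y).toLinearMap, g.innerDual_comm y (mvfderiv (𝓡 n) Q y).toLinearMap]
  have hfd : ∀ y, HasDerivWithinAt (fun s ↦ φ s y) (derivWithin (fun s ↦ φ s y) S t) S t := fun y ↦
    hasDerivWithinAt_time_of_contMDiffOn (by simp) hφ y ht
  have hqfam := contMDiffOn_gradSq_family g hS hφ
  have hqd' : ∀ y, HasDerivWithinAt (fun s ↦ g.gradSq (φ s) y)
      (derivWithin (fun s ↦ g.gradSq (φ s) y) S t) S t := fun y ↦
    hasDerivWithinAt_time_of_contMDiffOn (by simp) hqfam y ht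
  have hder : ∀ y, derivWithin (fun s ↦ g.gradSq (φ s) y * Real.exp (-φ s y) * Real.exp (-V y)) S t =
      (2 * g.innerDual y (mvfderiv (𝓡 n) F y).toLinearMap (mvfderiv (𝓡 n) LF y).toLinearMap
        - 2 * g.innerDual y (mvfderiv (𝓡 n) F y).toLinearMap (mvfderiv (𝓡 n) Q y).toLinearMap
        - Q y * LF y + Q y ^ 2) * E y * Real.exp (-V y) := by
    intro y
    have hu : HasDerivWithinAt (fun s ↦ Real.exp (-φ s y))
        (Real.exp (-φ t y) * -(derivWithin (fun s ↦ φ s y) S t)) S t := ((hfd y).neg).exp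
    have h : derivWithin (fun s ↦ g.gradSq (φ s) y * Real.exp (-φ s y) * Real.exp (-V y)) S t =
        (derivWithin (fun s ↦ g.gradSq (φ s) y) S t * Real.exp (-φ t y)
          + g.gradSq (φ t) y * (Real.exp (-φ t y) * -(derivWithin (fun s ↦ φ s y) S t))) * Real.exp (-V y) :=
      (((hqd' y).mul hu).mul_const (Real.exp (-V y))).derivWithin (hS t ht)
    rw [h, hqd y, heq t ht y]
    simp only [hEdef, hQdef, hFdef, hLFdef]
    ring
  /- Step 2: the two Green identities -/
  -- (G1): against `e^{-F} η²`, with `u = Q`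
  have hG1 := integral_mul_cutoffSq_mul_weightedLaplacian hg (a := E) hE hQ hη hηc hV
  have hdE : ∀ y, g.innerDual y (mvfderiv (𝓡 n) E y).toLinearMap (mvfderiv (𝓡 n) Q y).toLinearMap =
      -E y * g.innerDual y (mvfderiv (𝓡 n) F y).toLinearMap (mvfderiv (𝓡 n) Q y).toLinearMap := fun y ↦
    innerDual_mvfderiv_exp_neg_left (hFd y) _
  -- (G2): against `e^{-F} Q η²`, with `u = F`
  have hEQ : ContMDiff (𝓡 n) 𝓘(ℝ, ℝ) ∞ (fun y ↦ E y * Q y) := hE.mul hQ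
  have hG2 := integral_mul_cutoffSq_mul_weightedLaplacian hg (a := fun y ↦ E y * Q y) hEQ hF hη hηc hV
  have hdEQ : ∀ y, g.innerDual y (mvfderiv (𝓡 n) (fun z ↦ E z * Q z) y).toLinearMap
        (mvfderiv (𝓡 n) F y).toLinearMap =
      E y * g.innerDual y (mvfderiv (𝓡 n) Q y).toLinearMap (mvfderiv (𝓡 n) F y).toLinearMap
        - E y * Q y * Q y := by
    intro y
    rw [innerDual_mvfderiv_mul_left (hEd y) (hQd y), innerDual_mvfderiv_exp_neg_left (hFd y)]
    have : g.innerDual y (mvfderiv (𝓡 n) F y).toLinearMap (mvfderiv (𝓡 n) F y).toLinearMap = Q y := rfl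
    rw [this]
    ring
  have hsymQF : ∀ y, g.innerDual y (mvfderiv (𝓡 n) Q y).toLinearMap (mvfderiv (𝓡 n) F y).toLinearMap =
      g.innerDual y (mvfderiv (𝓡 n) F y).toLinearMap (mvfderiv (𝓡 n) Q y).toLinearMap := fun y ↦
    g.innerDual_comm y _ _
  /- Step 3: continuity, supports, integrability of all the pieces -/
  have hηcont : Continuous η := hη.continuous
  have hη2c : HasCompactSupport (fun y ↦ η y ^ 2) := by
    rw [show (fun y ↦ η y ^ 2) = fun y ↦ η y * η y from funext fun y ↦ sq (η y)]
    exact hηc.mul_right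
  have hgradη : Continuous (g.gradSq η) := (contMDiff_gradSq g hη).continuous
  have hgradηs : HasCompactSupport (g.gradSq η) :=
    HasCompactSupport.intro hηc fun y hy ↦ gradSq_eq_zero_of_notMem_tsupport hy
  have hV1 := hV.of_le h1le
  have hIFLF : Continuous fun y ↦ g.innerDual y (mvfderiv (𝓡 n) F y).toLinearMap
      (mvfderiv (𝓡 n) LF y).toLinearMap := continuous_innerDual_mvfderiv g (hF.of_le h1le) (hLF.of_le h1le)
  have hIFQ : Continuous fun y ↦ g.innerDual y (mvfderiv (𝓡 n) F y).toLinearMap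
      (mvfderiv (𝓡 n) Q y).toLinearMap := continuous_innerDual_mvfderiv g (hF.of_le h1le) (hQ.of_le h1le)
  have hIηQ : Continuous fun y ↦ g.innerDual y (mvfderiv (𝓡 n) η y).toLinearMap
      (mvfderiv (𝓡 n) Q y).toLinearMap := continuous_innerDual_mvfderiv g (hη.of_le h1le) (hQ.of_le h1le)
  have hIηF : Continuous fun y ↦ g.innerDual y (mvfderiv (𝓡 n) η y).toLinearMap
      (mvfderiv (𝓡 n) F y).toLinearMap := continuous_innerDual_mvfderiv g (hη.of_le h1le) (hF.of_le h1le)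
  have hLQc : Continuous LQ :=
    (continuous_dalembertian g (hQ.of_le h2le)).sub (continuous_innerDual_mvfderiv g hV1 (hQ.of_le h1le))
  have hSlc : Continuous Sl := ((continuous_const.mul hLQc).sub hIFLF).sub (continuous_const.mul hQ.continuous)
  have hEc : Continuous E := hE.continuous
  have hQc : Continuous Q := hQ.continuous
  have hLFc : Continuous LF := hLF.continuous
  -- generic integrability of `η² · (continuous)` and `η · (continuous)` products
  have int2 : ∀ {P : M → ℝ}, Continuous P → Integrable (fun y ↦ η y ^ 2 * P y) μ := fun {P} hP ↦
    integrable_of_continuous_of_hasCompactSupport' hg ((hηcont.pow 2).mul hP) (hη2c.mul_right)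
  have int1 : ∀ {P : M → ℝ}, Continuous P → Integrable (fun y ↦ η y * P y) μ := fun {P} hP ↦
    integrable_of_continuous_of_hasCompactSupport' hg (hηcont.mul hP) (hηc.mul_right)
  /- Step 4: the left-hand side as `−2K I_η − 2∫η²Sl E e^{-V} − 2∫Eη g(dη,dQ)e^{-V} + 2∫EQη g(dη,dF)e^{-V}` -/
  -- names for the basic integrals
  set Iη : ℝ := ∫ y, η y ^ 2 * (Q y * E y * Real.exp (-V y)) ∂μ with hIηdef
  set ISl : ℝ := ∫ y, η y ^ 2 * (Sl y * E y * Real.exp (-V y)) ∂μ with hISldef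
  set IFQ : ℝ := ∫ y, η y ^ 2 * (g.innerDual y (mvfderiv (𝓡 n) F y).toLinearMap
      (mvfderiv (𝓡 n) Q y).toLinearMap * E y * Real.exp (-V y)) ∂μ with hIFQdef
  set IQLF : ℝ := ∫ y, η y ^ 2 * (Q y * LF y * E y * Real.exp (-V y)) ∂μ with hIQLFdef
  set IQQ : ℝ := ∫ y, η y ^ 2 * (Q y ^ 2 * E y * Real.exp (-V y)) ∂μ with hIQQdef
  set ILQ : ℝ := ∫ y, η y ^ 2 * (LQ y * E y * Real.exp (-V y)) ∂μ with hILQdef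
  set JηQ : ℝ := ∫ y, η y * (E y * g.innerDual y (mvfderiv (𝓡 n) η y).toLinearMap
      (mvfderiv (𝓡 n) Q y).toLinearMap * Real.exp (-V y)) ∂μ with hJηQdef
  set JηF : ℝ := ∫ y, η y * (E y * Q y * g.innerDual y (mvfderiv (𝓡 n) η y).toLinearMap
      (mvfderiv (𝓡 n) F y).toLinearMap * Real.exp (-V y)) ∂μ with hJηFdef
  -- (i) the left-hand side
  have hLHS : ∫ y, η y ^ 2 * derivWithin (fun s ↦ g.gradSq (φ s) y * Real.exp (-φ s y) * Real.exp (-V y)) S t ∂μ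
      = ILQ - 2 * K * Iη - 2 * ISl - 2 * IFQ - IQLF + IQQ := by
    have e1 : ∫ y, η y ^ 2 * derivWithin (fun s ↦ g.gradSq (φ s) y * Real.exp (-φ s y) * Real.exp (-V y)) S t ∂μ
        = ∫ y, (η y ^ 2 * (LQ y * E y * Real.exp (-V y)) - 2 * K * (η y ^ 2 * (Q y * E y * Real.exp (-V y)))
          - 2 * (η y ^ 2 * (Sl y * E y * Real.exp (-V y)))
          - 2 * (η y ^ 2 * (g.innerDual y (mvfderiv (𝓡 n) F y).toLinearMap
              (mvfderiv (𝓡 n) Q y).toLinearMap * E y * Real.exp (-V y)))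
          - η y ^ 2 * (Q y * LF y * E y * Real.exp (-V y))
          + η y ^ 2 * (Q y ^ 2 * E y * Real.exp (-V y))) ∂μ := by
      refine integral_congr_ae (Eventually.of_forall fun y ↦ ?_)
      dsimp only
      rw [hder y]
      simp only [hSldef]
      ring
    rw [e1]
    have i1 : Integrable (fun y ↦ η y ^ 2 * (LQ y * E y * Real.exp (-V y))) μ :=
      int2 (P := fun y ↦ LQ y * E y * Real.exp (-V y)) ((hLQc.mul hEc).mul hW)
    have i2 : Integrable (fun y ↦ 2 * K * (η y ^ 2 * (Q y * E y * Real.exp (-V y)))) μ :=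
      (int2 (P := fun y ↦ Q y * E y * Real.exp (-V y)) ((hQc.mul hEc).mul hW)).const_mul _
    have i3 : Integrable (fun y ↦ 2 * (η y ^ 2 * (Sl y * E y * Real.exp (-V y)))) μ :=
      (int2 (P := fun y ↦ Sl y * E y * Real.exp (-V y)) ((hSlc.mul hEc).mul hW)).const_mul _
    have i4 : Integrable (fun y ↦ 2 * (η y ^ 2 * (g.innerDual y (mvfderiv (𝓡 n) F y).toLinearMap
        (mvfderiv (𝓡 n) Q y).toLinearMap * E y * Real.exp (-V y)))) μ :=
      (int2 (P := fun y ↦ g.innerDual y (mvfderiv (𝓡 n) F y).toLinearMap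
        (mvfderiv (𝓡 n) Q y).toLinearMap * E y * Real.exp (-V y)) ((hIFQ.mul hEc).mul hW)).const_mul _
    have i5 : Integrable (fun y ↦ η y ^ 2 * (Q y * LF y * E y * Real.exp (-V y))) μ :=
      int2 (P := fun y ↦ Q y * LF y * E y * Real.exp (-V y)) (((hQc.mul hLFc).mul hEc).mul hW)
    have i6 : Integrable (fun y ↦ η y ^ 2 * (Q y ^ 2 * E y * Real.exp (-V y))) μ :=
      int2 (P := fun y ↦ Q y ^ 2 * E y * Real.exp (-V y)) (((hQc.pow 2).mul hEc).mul hW)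
    have i12 : Integrable (fun y ↦ η y ^ 2 * (LQ y * E y * Real.exp (-V y))
        - 2 * K * (η y ^ 2 * (Q y * E y * Real.exp (-V y)))) μ := i1.sub i2
    have i123 : Integrable (fun y ↦ η y ^ 2 * (LQ y * E y * Real.exp (-V y))
        - 2 * K * (η y ^ 2 * (Q y * E y * Real.exp (-V y)))
        - 2 * (η y ^ 2 * (Sl y * E y * Real.exp (-V y)))) μ := i12.sub i3
    have i1234 : Integrable (fun y ↦ η y ^ 2 * (LQ y * E y * Real.exp (-V y))
        - 2 * K * (η y ^ 2 * (Q y * E y * Real.exp (-V y)))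
        - 2 * (η y ^ 2 * (Sl y * E y * Real.exp (-V y)))
        - 2 * (η y ^ 2 * (g.innerDual y (mvfderiv (𝓡 n) F y).toLinearMap
            (mvfderiv (𝓡 n) Q y).toLinearMap * E y * Real.exp (-V y)))) μ := i123.sub i4
    have i12345 : Integrable (fun y ↦ η y ^ 2 * (LQ y * E y * Real.exp (-V y))
        - 2 * K * (η y ^ 2 * (Q y * E y * Real.exp (-V y)))
        - 2 * (η y ^ 2 * (Sl y * E y * Real.exp (-V y)))
        - 2 * (η y ^ 2 * (g.innerDual y (mvfderiv (𝓡 n) F y).toLinearMap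
            (mvfderiv (𝓡 n) Q y).toLinearMap * E y * Real.exp (-V y)))
        - η y ^ 2 * (Q y * LF y * E y * Real.exp (-V y))) μ := i1234.sub i5
    rw [integral_add i12345 i6, integral_sub i1234 i5, integral_sub i123 i4, integral_sub i12 i3,
      integral_sub i1 i2, integral_const_mul, integral_const_mul, integral_const_mul]
  -- (ii) Green (G1): `ILQ = IFQ - 2 JηQ`
  have hILQ : ILQ = IFQ - 2 * JηQ := by
    have e0 : ILQ = ∫ y, E y * η y ^ 2 * (g.dalembertian Q y
        - g.innerDual y (mvfderiv (𝓡 n) V y).toLinearMap (mvfderiv (𝓡 n) Q y).toLinearMap) *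
        Real.exp (-V y) ∂μ := integral_congr_ae (Eventually.of_forall fun y ↦ by simp only [hLQdef]; ring)
    have e1 : -(∫ y, η y ^ 2 * g.innerDual y (mvfderiv (𝓡 n) E y).toLinearMap
          (mvfderiv (𝓡 n) Q y).toLinearMap * Real.exp (-V y) ∂μ) = IFQ := by
      rw [← integral_neg]
      refine integral_congr_ae (Eventually.of_forall fun y ↦ ?_)
      dsimp only
      rw [hdE y]; ring
    have e2 : ∫ y, E y * η y * g.innerDual y (mvfderiv (𝓡 n) η y).toLinearMap
        (mvfderiv (𝓡 n) Q y).toLinearMap * Real.exp (-V y) ∂μ = JηQ :=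
      integral_congr_ae (Eventually.of_forall fun y ↦ by ring)
    rw [e0, hG1, e1, e2]
  -- (iii) Green (G2): `IQLF = -(IFQ - IQQ) - 2 JηF`
  have hIQLF : IQLF = -(IFQ - IQQ) - 2 * JηF := by
    have e0 : IQLF = ∫ y, (E y * Q y) * η y ^ 2 * (g.dalembertian F y
        - g.innerDual y (mvfderiv (𝓡 n) V y).toLinearMap (mvfderiv (𝓡 n) F y).toLinearMap) *
        Real.exp (-V y) ∂μ := integral_congr_ae (Eventually.of_forall fun y ↦ by simp only [hLFdef]; ring)
    have iP : Integrable (fun y ↦ η y ^ 2 * (g.innerDual y (mvfderiv (𝓡 n) F y).toLinearMap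
        (mvfderiv (𝓡 n) Q y).toLinearMap * E y * Real.exp (-V y))) μ :=
      int2 (P := fun y ↦ g.innerDual y (mvfderiv (𝓡 n) F y).toLinearMap
        (mvfderiv (𝓡 n) Q y).toLinearMap * E y * Real.exp (-V y)) ((hIFQ.mul hEc).mul hW)
    have iQ2 : Integrable (fun y ↦ η y ^ 2 * (Q y ^ 2 * E y * Real.exp (-V y))) μ :=
      int2 (P := fun y ↦ Q y ^ 2 * E y * Real.exp (-V y)) (((hQc.pow 2).mul hEc).mul hW)
    have e1 : ∫ y, η y ^ 2 * g.innerDual y (mvfderiv (𝓡 n) (fun z ↦ E z * Q z) y).toLinearMap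
          (mvfderiv (𝓡 n) F y).toLinearMap * Real.exp (-V y) ∂μ = IFQ - IQQ := by
      rw [hIFQdef, hIQQdef, ← integral_sub iP iQ2]
      refine integral_congr_ae (Eventually.of_forall fun y ↦ ?_)
      dsimp only
      rw [hdEQ y, hsymQF y]; ring
    have e2 : ∫ y, E y * Q y * η y * g.innerDual y (mvfderiv (𝓡 n) η y).toLinearMap
        (mvfderiv (𝓡 n) F y).toLinearMap * Real.exp (-V y) ∂μ = JηF :=
      integral_congr_ae (Eventually.of_forall fun y ↦ by ring)
    rw [e0, hG2, e1, e2]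
  /- Step 5: the remainder is bounded pointwise -/
  have hrem : -2 * ISl - 2 * JηQ + 2 * JηF ≤ (2 * δ ^ 2 + 2 * δ * L₀) *
      ∫ y, g.gradSq (φ t) y * Real.exp (-φ t y) * Real.exp (-V y) ∂μ := by
    have j1 : Integrable (fun y ↦ -2 * (η y ^ 2 * (Sl y * E y * Real.exp (-V y)))) μ :=
      (int2 (P := fun y ↦ Sl y * E y * Real.exp (-V y)) ((hSlc.mul hEc).mul hW)).const_mul _
    have j2 : Integrable (fun y ↦ 2 * (η y * (E y * g.innerDual y (mvfderiv (𝓡 n) η y).toLinearMap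
        (mvfderiv (𝓡 n) Q y).toLinearMap * Real.exp (-V y)))) μ :=
      (int1 (P := fun y ↦ E y * g.innerDual y (mvfderiv (𝓡 n) η y).toLinearMap
        (mvfderiv (𝓡 n) Q y).toLinearMap * Real.exp (-V y)) ((hEc.mul hIηQ).mul hW)).const_mul _
    have j3 : Integrable (fun y ↦ 2 * (η y * (E y * Q y * g.innerDual y (mvfderiv (𝓡 n) η y).toLinearMap
        (mvfderiv (𝓡 n) F y).toLinearMap * Real.exp (-V y)))) μ :=
      (int1 (P := fun y ↦ E y * Q y * g.innerDual y (mvfderiv (𝓡 n) η y).toLinearMap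
        (mvfderiv (𝓡 n) F y).toLinearMap * Real.exp (-V y)) (((hEc.mul hQc).mul hIηF).mul hW)).const_mul _
    have j12 : Integrable (fun y ↦ -2 * (η y ^ 2 * (Sl y * E y * Real.exp (-V y)))
        - 2 * (η y * (E y * g.innerDual y (mvfderiv (𝓡 n) η y).toLinearMap
            (mvfderiv (𝓡 n) Q y).toLinearMap * Real.exp (-V y)))) μ := j1.sub j2
    have iL : Integrable (fun y ↦ -2 * (η y ^ 2 * (Sl y * E y * Real.exp (-V y)))
        - 2 * (η y * (E y * g.innerDual y (mvfderiv (𝓡 n) η y).toLinearMap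
            (mvfderiv (𝓡 n) Q y).toLinearMap * Real.exp (-V y)))
        + 2 * (η y * (E y * Q y * g.innerDual y (mvfderiv (𝓡 n) η y).toLinearMap
            (mvfderiv (𝓡 n) F y).toLinearMap * Real.exp (-V y)))) μ := j12.add j3
    have iR : Integrable (fun y ↦ (2 * δ ^ 2 + 2 * δ * L₀) *
        (g.gradSq (φ t) y * Real.exp (-φ t y) * Real.exp (-V y))) μ := hint.const_mul _
    have hmono := integral_mono iL iR fun y ↦ ?_
    · rw [integral_add j12 j3, integral_sub j1 j2, integral_const_mul, integral_const_mul, integral_const_mul,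
        integral_const_mul] at hmono
      exact hmono
    -- the pointwise bound at `y`
    have hEy := hE0 y
    have hWy : 0 ≤ Real.exp (-V y) := (Real.exp_pos _).le
    have hQ0 : 0 ≤ Q y := g.gradSq_nonneg hg F y
    have hGη0 : 0 ≤ g.gradSq η y := g.gradSq_nonneg hg η y
    set J := g.innerDual y (mvfderiv (𝓡 n) η y).toLinearMap (mvfderiv (𝓡 n) Q y).toLinearMap with hJ
    set I' := g.innerDual y (mvfderiv (𝓡 n) η y).toLinearMap (mvfderiv (𝓡 n) F y).toLinearMap with hI'
    -- the Hessian error absorbed into the slack: `-2 η J - 2 η² Sl ≤ 2 |∇η|² Q`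
    have ha := slack_absorb (ψ' := 1) (e := 1) (η := η y) zero_le_one zero_le_one (hSl0 y) hGη0 hQ0 (hslack y)
    have ha' : -(2 * (η y * J)) - 2 * (η y ^ 2 * Sl y) ≤ 2 * (g.gradSq η y * Q y) := by
      simpa only [one_mul, mul_one] using ha
    have hG1' : 2 * (g.gradSq η y * Q y) ≤ 2 * δ ^ 2 * Q y := by
      have h := mul_le_mul_of_nonneg_right (hηgrad y) hQ0
      linarith only [h]
    -- the cubic term: `2 η Q I' ≤ 2 δ L₀ Q`
    have hI'abs : |I'| ≤ δ * L₀ := by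
      have h1 := abs_innerDual_le_sqrt_gradSq_mul hg η F y
      have h2 : Real.sqrt (g.gradSq η y) ≤ δ := by
        rw [← Real.sqrt_sq hδ]; exact Real.sqrt_le_sqrt (hηgrad y)
      have h3 : Real.sqrt (g.gradSq F y) ≤ L₀ := by
        rw [← Real.sqrt_sq hL₀]; exact Real.sqrt_le_sqrt (hφgrad y)
      exact h1.trans (mul_le_mul h2 h3 (Real.sqrt_nonneg _) hδ)
    have hcubic : 2 * (η y * (Q y * I')) ≤ 2 * δ * L₀ * Q y := by
      have h1 : η y * (Q y * I') ≤ |η y * (Q y * I')| := le_abs_self _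
      have h2 : |η y * (Q y * I')| = |η y| * (Q y * |I'|) := by rw [abs_mul, abs_mul, abs_of_nonneg hQ0]
      have h3 : |η y| * (Q y * |I'|) ≤ 1 * (Q y * (δ * L₀)) :=
        mul_le_mul (hη1 y) (mul_le_mul_of_nonneg_left hI'abs hQ0) (mul_nonneg hQ0 (abs_nonneg _)) zero_le_one
      linarith only [h1, h2, h3]
    have hEW : 0 ≤ E y * Real.exp (-V y) := mul_nonneg hEy hWy
    have key := mul_le_mul_of_nonneg_right (add_le_add (ha'.trans hG1') hcubic) hEW
    have eφ : g.gradSq (φ t) y * Real.exp (-φ t y) * Real.exp (-V y) = Q y * (E y * Real.exp (-V y)) := by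
      simp only [hQdef, hEdef, hFdef]; ring
    rw [eφ]
    calc -2 * (η y ^ 2 * (Sl y * E y * Real.exp (-V y)))
          - 2 * (η y * (E y * J * Real.exp (-V y))) + 2 * (η y * (E y * Q y * I' * Real.exp (-V y)))
        = (-(2 * (η y * J)) - 2 * (η y ^ 2 * Sl y) + 2 * (η y * (Q y * I'))) * (E y * Real.exp (-V y)) := by
          ring
      _ ≤ (2 * δ ^ 2 * Q y + 2 * δ * L₀ * Q y) * (E y * Real.exp (-V y)) := key
      _ = (2 * δ ^ 2 + 2 * δ * L₀) * (Q y * (E y * Real.exp (-V y))) := by ring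
  /- Step 6: conclusion -/
  have hrem' : -2 * ISl - 2 * JηQ + 2 * JηF ≤ (2 * δ ^ 2 + 2 * δ * L₀) *
      ∫ y, Q y * Real.exp (-F y) * Real.exp (-V y) ∂μ := hrem
  rw [hLHS, hILQ, hIQLF]
  linarith only [hrem']

end Fisher

end Summit.SmoothPoincare4.SmoothPoincare4.Theorems.BakryEmeryComplete

end
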